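import Summits.MatrixMultiplication.OmegaCensus.STPPVosperSlackFourTablesZ61P3
import Summits.MatrixMultiplication.OmegaCensus.STPPVosperTilingWordsPrunedQ
import Summits.MatrixMultiplication.OmegaCensus.STPPVosperSlackTwoLawABQ

/-!
# ω-census (abelian STPP census): fifth leaf ℤ₆₁ {(2,2,2),(3,3,3)²} — dead-table rows for `tblZ61F5A1`, part 21 of 29 (kernel computations)

HONEST FRAMING (pub-omega census; verbatim): lottery ticket; floor = certified bounds/negative ranges.
Census STRUCTURE (seat pub-omega-stpp-2 gen 27 — rows service for the stpp-1 lineage's law, 2026-08-29), family (b2).  For each entry `e = (Yo, Zo)` of stpp-1 g33's dead table `tblZ61F5A1` (`STPPVosperSlackFourTablesZ61P3.lean`, 562 entries) the words-cover search of the two other blocks (3,3,3), (2,2,2) over stpp-2 g26's pruned enumerator `blockDiffsWQ` (direct orientation) returns `false` (≤ 3·10⁴ mirror steps each); g33's `coverDead_forall_of_rows` turns the assembled row into the law's `CoverDead` hypothesis.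
Each theorem is ONE `decide +kernel` over a range of table entries.  Assembly in `STPPVosperSlackFourRows61F5TblA1Asm.lean`.  Nothing here is progress on `ω`.
-/

namespace Summit.MatrixMultiplication.OmegaCensus.CubeNB.S2

open Summit.MatrixMultiplication.OmegaCensus.CubeNB

/-- Dead-table entries `[400, 404)` of `tblZ61F5A1`: the words-cover search fails. [folklore] -/
theorem dead61TblA1_c100 : ∀ e ∈ (tblZ61F5A1.drop 400).take 4, existsCoverW 61 e.1 e.2 [blockDiffsWQ 61 e.1 e.2 3 3 3, blockDiffsWQ 61 e.1 e.2 2 2 2] [] [] [] = false := by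
  decide +kernel

/-- Dead-table entries `[404, 408)` of `tblZ61F5A1`: the words-cover search fails. [folklore] -/
theorem dead61TblA1_c101 : ∀ e ∈ (tblZ61F5A1.drop 404).take 4, existsCoverW 61 e.1 e.2 [blockDiffsWQ 61 e.1 e.2 3 3 3, blockDiffsWQ 61 e.1 e.2 2 2 2] [] [] [] = false := by
  decide +kernel

/-- Dead-table entries `[408, 412)` of `tblZ61F5A1`: the words-cover search fails. [folklore] -/
theorem dead61TblA1_c102 : ∀ e ∈ (tblZ61F5A1.drop 408).take 4, existsCoverW 61 e.1 e.2 [blockDiffsWQ 61 e.1 e.2 3 3 3, blockDiffsWQ 61 e.1 e.2 2 2 2] [] [] [] = false := by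
  decide +kernel

/-- Dead-table entries `[412, 416)` of `tblZ61F5A1`: the words-cover search fails. [folklore] -/
theorem dead61TblA1_c103 : ∀ e ∈ (tblZ61F5A1.drop 412).take 4, existsCoverW 61 e.1 e.2 [blockDiffsWQ 61 e.1 e.2 3 3 3, blockDiffsWQ 61 e.1 e.2 2 2 2] [] [] [] = false := by
  decide +kernel

/-- Dead-table entries `[416, 420)` of `tblZ61F5A1`: the words-cover search fails. [folklore] -/
theorem dead61TblA1_c104 : ∀ e ∈ (tblZ61F5A1.drop 416).take 4, existsCoverW 61 e.1 e.2 [blockDiffsWQ 61 e.1 e.2 3 3 3, blockDiffsWQ 61 e.1 e.2 2 2 2] [] [] [] = false := by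
  decide +kernel

end Summit.MatrixMultiplication.OmegaCensus.CubeNB.S2
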